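import Summits.QuantumFields.YangMills.Theorems.ColdStartUniversalityLatticeLangevinAutocorrelationTimeUniform
import Summits.QuantumFields.YangMills.Theorems.ColdStartUniversalityUniformColdStartMixingFixedCutoffMixingTimeWindow
import HarnessLib

/-!
# Route `ColdStartUniversality`, aside K_A1 `UniformColdStartMixing` (24809) — INTEGRATED AUTOCORRELATION TIME AT A FIXED CUT-OFF IN THE
# STRONG-COUPLING WINDOW `γ ε_K > 6`, in the route's cut-off vocabulary: `τ_int(F) ≤ 1/(1 − 6/(γε_K))` lattice units for EVERY centred continuous
# observable, and Kipnis–Varadhan `∫₀^∞⟨s, P_t s⟩_(μ_K) dt ≤ 32/((1 − 6/(γε_K))²·3L_K³)` for the centred action density `s`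

Helper file (seat `ym-line-csu-p1`, g27; `--supports stmt-QuantumFields-24809`).  Planner-facing reading of `…AutocorrelationTimeUniform` at the
cut-off coupling `β'_K = (γε_K)⁻¹/2` on `(ℤ/L_K)³`, `L_K = (F.P K).sitesPerDir 0` (`#𝒫 = 3L_K³`, `1 − 12|β'_K| = 1 − 6/(γε_K)`):
* ★★ `autocorrelationTime_fixedCutoff_window` — for `6 < γ ε_K`, every realising kernel family of the SZZ dynamics at `β'_K` and every centred
  continuous `F₁`: `t ↦ ⟨F₁, κ_tF₁⟩_(μ_K)` is integrable on `(0,∞)`, its integral is `≥ 0` and `≤ ‖F₁‖²_(L²(μ_K))/(1 − 6/(γε_K))` — i.e. the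
  integrated autocorrelation time is at most `1/(1 − 6/(γε_K))` lattice units (`ε_K/(1 − 6/(γε_K))` in the crux's physical time), uniformly in `L_K`;
* ★★ `actionDensity_asymptoticVariance_fixedCutoff_window` — `∫₀^∞ ⟨s, κ_t s⟩_(μ_K) dt ≤ 32/((1 − 6/(γε_K))²·(3L_K³))` for the centred action
  density `s = S_W/(3L_K³) − ⟨S_W/(3L_K³)⟩`: the Kipnis–Varadhan asymptotic variance of its time average is `O(1/L_K³)`.
[cite: RobertsRosenthal1997, Theorem 2.1] [cite: ShenZhuZhu2022, §4 Theorem 4.2]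
PLANNER-FACING, HONEST: the window `γ ε_K > 6` contains only the COARSE cut-offs; nothing K-uniform is proved; 24809 is ASIDE and NOT restated;
no crux, rung of the ladder or summit statement is proved; the Yang–Mills mass gap is NOT proved.
-/

set_option autoImplicit false

noncomputable section

namespace Summit.QuantumFields.YangMills.Theorems.ColdStartUniversality

open MeasureTheory ProbabilityTheory Finset Set
open scoped NNReal ENNReal BigOperators
open Literature.Probability.Process Literature.MathematicalPhysics.QuantumFieldTheory
open Literature.MathematicalPhysics.QuantumLattice (fundamentalRep fundamentalLatticeRep continuous_fundamentalRep)
open Literature.MathematicalPhysics.QuantumFieldTheory.Balaban1983to89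

/-- ★★ **Integrated autocorrelation time at a cut-off in the window.**  For `6 < γ ε_K`, every realising kernel family `κ` of the SZZ dynamics at
`β'_K` and every centred continuous `F₁`: `∫₀^∞ ⟨F₁, κ_tF₁⟩_(μ_K) dt` exists, is `≥ 0`, and is `≤ ‖F₁‖²_(L²(μ_K)) / (1 − 6/(γε_K))`.
[cite: RobertsRosenthal1997, Theorem 2.1] -/
theorem autocorrelationTime_fixedCutoff_window (F : T3ContinuumYM3Torus.T3Family) (γ : ℝ) (K : ℕ) (hK : 6 < γ * (F.P K).eps)
    (κ : ℝ≥0 → Kernel (GaugeConfig 3 ((F.P K).sitesPerDir 0) (Matrix.specialUnitaryGroup (Fin 2) ℂ)) (GaugeConfig 3 ((F.P K).sitesPerDir 0) (Matrix.specialUnitaryGroup (Fin 2) ℂ))) [∀ t, IsMarkovKernel (κ t)]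
    (hreal : ∀ (t : ℝ≥0) (x : (GaugeConfig 3 ((F.P K).sitesPerDir 0) (Matrix.specialUnitaryGroup (Fin 2) ℂ)))
        (Ω : Type) [MeasurableSpace Ω] (P : Measure Ω) [IsProbabilityMeasure P]
        (W : ℝ≥0 → Ω → (Edge 3 ((F.P K).sitesPerDir 0) × NoiseIdx 2 → ℝ)) (hW : IsFlatBrownian W P)
        (U : ℝ≥0 → Ω → (GaugeConfig 3 ((F.P K).sitesPerDir 0) (Matrix.specialUnitaryGroup (Fin 2) ℂ))),
        (∀ ω, U 0 ω = x) →
        (latticeLangevinDynamics (fundamentalLatticeRep 2) ((γ * (F.P K).eps)⁻¹ / 2)).IsSolution (fundamentalRep (Fin 2))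
          hW.natFiltration P W U →
        κ t x = P.map (U t))
    (F₁ : (GaugeConfig 3 ((F.P K).sitesPerDir 0) (Matrix.specialUnitaryGroup (Fin 2) ℂ)) → ℝ) (hF : Continuous F₁) (hF0 : ∫ x, F₁ x ∂(wilsonMeasure (d := 3) (L := ((F.P K).sitesPerDir 0)) (fundamentalRep (Fin 2)) ((γ * (F.P K).eps)⁻¹ / 2)) = 0) :
    IntegrableOn (fun t : ℝ => ∫ x, F₁ x * (∫ y, F₁ y ∂(κ t.toNNReal x)) ∂(wilsonMeasure (d := 3) (L := ((F.P K).sitesPerDir 0)) (fundamentalRep (Fin 2)) ((γ * (F.P K).eps)⁻¹ / 2))) (Ioi (0 : ℝ)) ∧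
    0 ≤ ∫ t in Ioi (0 : ℝ), (∫ x, F₁ x * (∫ y, F₁ y ∂(κ t.toNNReal x)) ∂(wilsonMeasure (d := 3) (L := ((F.P K).sitesPerDir 0)) (fundamentalRep (Fin 2)) ((γ * (F.P K).eps)⁻¹ / 2))) ∧
    ∫ t in Ioi (0 : ℝ), (∫ x, F₁ x * (∫ y, F₁ y ∂(κ t.toNNReal x)) ∂(wilsonMeasure (d := 3) (L := ((F.P K).sitesPerDir 0)) (fundamentalRep (Fin 2)) ((γ * (F.P K).eps)⁻¹ / 2))) ≤
      (∫ x, F₁ x * F₁ x ∂(wilsonMeasure (d := 3) (L := ((F.P K).sitesPerDir 0)) (fundamentalRep (Fin 2)) ((γ * (F.P K).eps)⁻¹ / 2))) / (1 - 6 / (γ * (F.P K).eps)) := by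
  obtain ⟨hβ, hrate⟩ := window_coupling_bounds F γ K hK
  have h := wilson_autocorrelation_le_uniform ((F.P K).sitesPerDir 0) ((γ * (F.P K).eps)⁻¹ / 2) hβ κ hreal F₁ hF hF0
  rw [hrate] at h
  exact h

/-- ★★ **Kipnis–Varadhan asymptotic variance of the time-averaged action density at a cut-off in the window.**  For `6 < γ ε_K` and every
realising kernel family `κ` of the SZZ dynamics at `β'_K`, with `s = S_W/(3L_K³) − ⟨S_W/(3L_K³)⟩_(μ_K)`:
`∫₀^∞ ⟨s, κ_t s⟩_(μ_K) dt ≤ 32/((1 − 6/(γε_K))²·(3L_K³))`. [cite: ShenZhuZhu2022, §4 Theorem 4.2] -/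
theorem actionDensity_asymptoticVariance_fixedCutoff_window (F : T3ContinuumYM3Torus.T3Family) (γ : ℝ) (K : ℕ) (hK : 6 < γ * (F.P K).eps)
    (κ : ℝ≥0 → Kernel (GaugeConfig 3 ((F.P K).sitesPerDir 0) (Matrix.specialUnitaryGroup (Fin 2) ℂ)) (GaugeConfig 3 ((F.P K).sitesPerDir 0) (Matrix.specialUnitaryGroup (Fin 2) ℂ))) [∀ t, IsMarkovKernel (κ t)]
    (hreal : ∀ (t : ℝ≥0) (x : (GaugeConfig 3 ((F.P K).sitesPerDir 0) (Matrix.specialUnitaryGroup (Fin 2) ℂ)))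
        (Ω : Type) [MeasurableSpace Ω] (P : Measure Ω) [IsProbabilityMeasure P]
        (W : ℝ≥0 → Ω → (Edge 3 ((F.P K).sitesPerDir 0) × NoiseIdx 2 → ℝ)) (hW : IsFlatBrownian W P)
        (U : ℝ≥0 → Ω → (GaugeConfig 3 ((F.P K).sitesPerDir 0) (Matrix.specialUnitaryGroup (Fin 2) ℂ))),
        (∀ ω, U 0 ω = x) →
        (latticeLangevinDynamics (fundamentalLatticeRep 2) ((γ * (F.P K).eps)⁻¹ / 2)).IsSolution (fundamentalRep (Fin 2))
          hW.natFiltration P W U →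
        κ t x = P.map (U t)) :
    ∫ t in Ioi (0 : ℝ), (∫ x, (wilsonAction (fundamentalRep (Fin 2)) x / (3 * ((((F.P K).sitesPerDir 0) : ℕ) : ℝ) ^ 3) - ∫ V', wilsonAction (fundamentalRep (Fin 2)) V' / (3 * ((((F.P K).sitesPerDir 0) : ℕ) : ℝ) ^ 3) ∂(wilsonMeasure (d := 3) (L := ((F.P K).sitesPerDir 0)) (fundamentalRep (Fin 2)) ((γ * (F.P K).eps)⁻¹ / 2))) * (∫ y, (wilsonAction (fundamentalRep (Fin 2)) y / (3 * ((((F.P K).sitesPerDir 0) : ℕ) : ℝ) ^ 3) - ∫ V', wilsonAction (fundamentalRep (Fin 2)) V' / (3 * ((((F.P K).sitesPerDir 0) : ℕ) : ℝ) ^ 3) ∂(wilsonMeasure (d := 3) (L := ((F.P K).sitesPerDir 0)) (fundamentalRep (Fin 2)) ((γ * (F.P K).eps)⁻¹ / 2))) ∂(κ t.toNNReal x)) ∂(wilsonMeasure (d := 3) (L := ((F.P K).sitesPerDir 0)) (fundamentalRep (Fin 2)) ((γ * (F.P K).eps)⁻¹ / 2))) ≤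
      32 / ((1 - 6 / (γ * (F.P K).eps)) ^ 2 * (3 * ((((F.P K).sitesPerDir 0) : ℕ) : ℝ) ^ 3)) := by
  obtain ⟨hβ, hrate⟩ := window_coupling_bounds F γ K hK
  have hc : (Fintype.card (Plaquette 3 ((F.P K).sitesPerDir 0)) : ℝ) = 3 * ((((F.P K).sitesPerDir 0) : ℕ) : ℝ) ^ 3 := by
    rw [card_plaquette_three]; push_cast; ring
  have h := wilson_actionDensity_asymptoticVariance_uniform ((F.P K).sitesPerDir 0) ((γ * (F.P K).eps)⁻¹ / 2) hβ κ hreal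
  rw [hc, hrate] at h
  exact h

end Summit.QuantumFields.YangMills.Theorems.ColdStartUniversality
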